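import Summits.AtomisticToContinuum.FouriersLaw.Theorems.LocalEnergyHalfHoelder.Negative.UniformOscillationFlow

/-!
# Uniform-oscillation arena for `LocalEnergyHalfHoelder` (stmt-AtomisticToContinuum-16008), part 2/3:
# the uniform dynamics of the pinned chain and its invariant state

Support file (refuter / crux disprover; see part 3/3 `FalseWithoutGibbs.lean`). Contents, all
proved: `embed`/`proj` between one-body data and spatially uniform chain configurations; the carrier
`unifCarrier` (uniform configurations with one-body datum in the shell); the UNIFORM-OSCILLATION
DYNAMICS `unifDynamics : InfiniteChainDynamics (pinnedChain ω₂ lam β γ)` — the same Duffing orbit at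
every site (bond forces vanish identically on uniform configurations, so these are genuine solutions
of LLL (1a)–(1b); uniqueness within the carrier is Picard–Lindelöf for the cut-off field); the
UNIFORM STATE `μu` = normalised Liouville measure of the shell pushed to uniform configurations, a
probability measure that is shift-invariant, momentum-reversal-invariant, preserved by `unifDynamics`
(Liouville on the shell) and whose flow commutes with the shift `μu`-a.e. — i.e. EVERY guard of the
crux except the DLR equations.
-/

noncomputable section

open MeasureTheory Filter Set Metric
open scoped NNReal ENNReal

namespace Summit.AtomisticToContinuum.FouriersLaw.Theorems.LocalEnergyHalfHoelder.Negative.UniformOscillationArena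

open Literature.MathematicalPhysics.KineticTheory
open Literature.MathematicalPhysics.KineticTheory.HeatConduction
open Literature.MathematicalPhysics.KineticTheory.NewtonianFlow
open Summit.AtomisticToContinuum.FouriersLaw.Theorems.LocalEnergyHalfHoelder.Negative.UniformOscillationFlow

variable {ω₂ lam : ℝ}

/-! ### The uniform-oscillation arena of the pinned chain -/

/-- Spatially uniform chain configuration carrying the one-body datum `z`. [folklore] -/
def embed (z : PhaseSpace 1) : ChainConfig := fun _ => (z.1 0, z.2 0)

/-- The one-body datum read off at site `0`. [folklore] -/
def proj (σ : ChainConfig) : PhaseSpace 1 := (vec (σ 0).1, vec (σ 0).2)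

/-- Auxiliary (`embed_apply`), see the module docstring. [folklore] -/
@[simp] theorem embed_apply (z : PhaseSpace 1) (x : ℤ) : embed z x = (z.1 0, z.2 0) := rfl
/-- Auxiliary (`proj_fst_apply`), see the module docstring. [folklore] -/
@[simp] theorem proj_fst_apply (σ : ChainConfig) (i : Fin 1) : (proj σ).1 i = (σ 0).1 := rfl
/-- Auxiliary (`proj_snd_apply`), see the module docstring. [folklore] -/
@[simp] theorem proj_snd_apply (σ : ChainConfig) (i : Fin 1) : (proj σ).2 i = (σ 0).2 := rfl

/-- Auxiliary (`proj_embed`), see the module docstring. [folklore] -/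
theorem proj_embed (z : PhaseSpace 1) : proj (embed z) = z :=
  Prod.ext (eq_vec z.1).symm (eq_vec z.2).symm

/-- Auxiliary (`measurable_embed`), see the module docstring. [folklore] -/
theorem measurable_embed : Measurable embed :=
  measurable_pi_lambda _ fun _ =>
    ((measurable_pi_apply 0).comp measurable_fst).prodMk ((measurable_pi_apply 0).comp measurable_snd)

/-- Auxiliary (`measurable_proj`), see the module docstring. [folklore] -/
theorem measurable_proj : Measurable proj :=
  (measurable_pi_lambda _ fun _ => (measurable_pi_apply 0).fst).prodMk
    (measurable_pi_lambda _ fun _ => (measurable_pi_apply 0).snd)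

/-- Auxiliary (`shift_embed`), see the module docstring. [folklore] -/
theorem shift_embed (z : PhaseSpace 1) : shift (embed z) = embed z := rfl

/-- Auxiliary (`reversal_embed`), see the module docstring. [folklore] -/
theorem reversal_embed (z : PhaseSpace 1) :
    (fun x : ℤ => ((embed z x).1, -(embed z x).2)) = embed (rev1 z) := rfl

variable (ω₂ lam)

/-- The carrier: uniform configurations with one-body energy below the rim. [folklore] -/
def unifCarrier : Set ChainConfig := {σ | (∀ x, σ x = σ 0) ∧ proj σ ∈ shell ω₂ lam}

/-- Auxiliary (`measurableSet_unifCarrier`), see the module docstring. [folklore] -/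
theorem measurableSet_unifCarrier : MeasurableSet (unifCarrier ω₂ lam) := by
  have h1 : MeasurableSet {σ : ChainConfig | ∀ x, σ x = σ 0} := by
    have : {σ : ChainConfig | ∀ x, σ x = σ 0} = ⋂ x : ℤ, {σ | σ x = σ 0} := by ext σ; simp
    rw [this]
    exact MeasurableSet.iInter fun x => measurableSet_eq_fun (measurable_pi_apply x) (measurable_pi_apply 0)
  exact h1.inter (measurable_proj (measurableSet_shell ω₂ lam))

variable {ω₂ lam}

/-- Auxiliary (`embed_mem_unifCarrier`), see the module docstring. [folklore] -/
theorem embed_mem_unifCarrier {z : PhaseSpace 1} : embed z ∈ unifCarrier ω₂ lam ↔ z ∈ shell ω₂ lam := by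
  simp [unifCarrier, proj_embed]

/-- Auxiliary (`eq_embed_proj`), see the module docstring. [folklore] -/
theorem eq_embed_proj {σ : ChainConfig} (hσ : σ ∈ unifCarrier ω₂ lam) : σ = embed (proj σ) := by
  funext x; rw [hσ.1 x]; rfl

/-- Auxiliary (`pinnedChain_U`), see the module docstring. [folklore] -/
theorem pinnedChain_U (β γ : ℝ) : (pinnedChain ω₂ lam β γ).U = Upin ω₂ lam := rfl

/-- Auxiliary (`pinnedChain_V_zero`), see the module docstring. [folklore] -/
theorem pinnedChain_V_zero (β γ : ℝ) : (pinnedChain ω₂ lam β γ).V 0 = 0 := by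
  show (0:ℝ) ^ 2 / 2 + β * 0 ^ 4 / 4 = 0; norm_num

/-- Auxiliary (`force_embed`), see the module docstring. [folklore] -/
theorem force_embed (β γ : ℝ) (w : PhaseSpace 1) (i : ℤ) :
    (pinnedChain ω₂ lam β γ).force (embed w) i = -(ω₂ * w.1 0 + lam * w.1 0 ^ 3) := by
  simp [OscillatorChain.force, OscillatorChain.interactionForce, pinnedChain_U,
    (hasDerivAt_Upin ω₂ lam _).deriv]

/-- **The uniform-oscillation dynamics**: every site carries the same one-body Duffing orbit
below the rim (interaction forces vanish identically on uniform configurations); uniqueness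
within the carrier is Picard–Lindelöf for the cut-off one-body field. [folklore] -/
def unifDynamics (hω : 0 ≤ ω₂) (hl : 0 ≤ lam) (β γ : ℝ) :
    InfiniteChainDynamics (pinnedChain ω₂ lam β γ) where
  carrier := unifCarrier ω₂ lam
  flow t σ := embed (Φ ω₂ lam t (proj σ))
  mapsTo t σ hσ := by
    show embed (Φ ω₂ lam t (proj σ)) ∈ unifCarrier ω₂ lam
    rw [embed_mem_unifCarrier]
    exact Φ_mem_shell hω hl hσ.2 t
  flow_zero σ hσ := by
    show embed (Φ ω₂ lam 0 (proj σ)) = σ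
    rw [(isFlow_Φ ω₂ lam).2.1, ← eq_embed_proj hσ]
  isSolution σ hσ := by
    intro i t
    refine ⟨hasDerivAt_Φ_fst ω₂ lam (proj σ) t, ?_⟩
    show HasDerivAt (fun s => (Φ ω₂ lam s (proj σ)).2 0)
      ((pinnedChain ω₂ lam β γ).force (embed (Φ ω₂ lam t (proj σ))) i) t
    rw [force_embed, ← g_eq_of_abs_le ω₂ lam ((shell_invariant hω hl hσ.2 t).2).le]
    exact hasDerivAt_Φ_snd ω₂ lam (proj σ) t
  unique c hc hsol t := by
    set w : ℝ → PhaseSpace 1 := fun s => proj (c s) with hw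
    have hcs : ∀ s, c s = embed (w s) := fun s => eq_embed_proj (hc s)
    have hderiv : ∀ s, HasDerivAt w (vectorField (cutoff 0 (duffingForce ω₂ lam)) (w s)) s := by
      intro s
      refine HasDerivAt.prodMk (hasDerivAt_pi.mpr fun i => ?_) (hasDerivAt_pi.mpr fun i => ?_)
      · exact (hsol 0 s).1
      · have h2 := (hsol 0 s).2
        rw [hcs s, force_embed, ← g_eq_of_abs_le ω₂ lam (abs_fst_lt_one_of_Hd_lt hω hl (hc s).2).le] at h2
        show HasDerivAt (fun u => (c u 0).2) ((cutoff 0 (duffingForce ω₂ lam) (w s).1) i) s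
        rw [Subsingleton.elim i 0, cutoff_apply_eq_g]
        exact h2
    have hflow := isSolutionFamily_Φ.eq_apply contDiff_cut hderiv t
    show c t = embed (Φ ω₂ lam t (proj (c 0)))
    rw [hcs t]
    exact congrArg embed hflow

/-- Auxiliary (`unifDynamics_flow`), see the module docstring. [folklore] -/
@[simp] theorem unifDynamics_flow (hω : 0 ≤ ω₂) (hl : 0 ≤ lam) (β γ : ℝ) (t : ℝ) (σ : ChainConfig) :
    (unifDynamics hω hl β γ).flow t σ = embed (Φ ω₂ lam t (proj σ)) := rfl

/-! ### The invariant state: normalised Liouville measure of the shell, on uniform configurations -/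

variable (ω₂ lam)

/-- Normalised Lebesgue measure of the shell (one-body microcanonical slab). [folklore] -/
def ρ : Measure (PhaseSpace 1) := ProbabilityTheory.cond volume (shell ω₂ lam)

/-- Its image on uniform chain configurations. [folklore] -/
def μu : Measure ChainConfig := (ρ ω₂ lam).map embed

variable {ω₂ lam}

/-- Auxiliary (`ρ_def`), see the module docstring. [folklore] -/
theorem ρ_def : ρ ω₂ lam = (volume (shell ω₂ lam))⁻¹ • volume.restrict (shell ω₂ lam) := rfl

/-- Auxiliary (`isProbabilityMeasure_ρ'`), see the module docstring. [folklore] -/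
theorem isProbabilityMeasure_ρ' (hω : 0 < ω₂) (hl : 0 ≤ lam) : IsProbabilityMeasure (ρ ω₂ lam) :=
  ProbabilityTheory.cond_isProbabilityMeasure_of_finite (volume_shell_ne_zero hω hl)
    (volume_shell_ne_top hω.le hl)

/-- Auxiliary (`isProbabilityMeasure_μu`), see the module docstring. [folklore] -/
theorem isProbabilityMeasure_μu (hω : 0 < ω₂) (hl : 0 ≤ lam) : IsProbabilityMeasure (μu ω₂ lam) :=
  haveI := isProbabilityMeasure_ρ' hω hl
  Measure.isProbabilityMeasure_map measurable_embed.aemeasurable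

/-- Auxiliary (`ae_ρ_mem_shell`), see the module docstring. [folklore] -/
theorem ae_ρ_mem_shell : ∀ᵐ z ∂(ρ ω₂ lam), z ∈ shell ω₂ lam :=
  ProbabilityTheory.ae_cond_mem (measurableSet_shell ω₂ lam)

/-- Auxiliary (`ae_μu_mem_carrier`), see the module docstring. [folklore] -/
theorem ae_μu_mem_carrier : ∀ᵐ σ ∂(μu ω₂ lam), σ ∈ unifCarrier ω₂ lam := by
  unfold μu
  refine (ae_map_iff measurable_embed.aemeasurable (measurableSet_unifCarrier ω₂ lam)).mpr ?_
  filter_upwards [ae_ρ_mem_shell] with z hz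
  exact embed_mem_unifCarrier.mpr hz

/-- Auxiliary (`measurePreserving_Φ_ρ`), see the module docstring. [folklore] -/
theorem measurePreserving_Φ_ρ (hω : 0 ≤ ω₂) (hl : 0 ≤ lam) (t : ℝ) :
    MeasurePreserving (Φ ω₂ lam t) (ρ ω₂ lam) (ρ ω₂ lam) :=
  (measurePreserving_Φ_restrict hω hl t).smul_measure _

/-- Auxiliary (`measurePreserving_rev1_ρ`), see the module docstring. [folklore] -/
theorem measurePreserving_rev1_ρ : MeasurePreserving rev1 (ρ ω₂ lam) (ρ ω₂ lam) :=
  measurePreserving_rev1_restrict.smul_measure _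

/-- Shift invariance of the uniform state. [folklore] -/
theorem isShiftInvariant_μu : IsShiftInvariant (μu ω₂ lam) := by
  have hshift : Measurable (shift : ChainConfig → ChainConfig) :=
    measurable_pi_lambda _ fun x => measurable_pi_apply (x + 1)
  unfold IsShiftInvariant μu
  rw [Measure.map_map hshift measurable_embed]
  rfl

/-- Momentum-reversal invariance of the uniform state. [folklore] -/
theorem reversal_μu :
    (μu ω₂ lam).map (fun σ : ChainConfig => fun x : ℤ => ((σ x).1, -(σ x).2)) = μu ω₂ lam := by
  have hrev : Measurable (fun σ : ChainConfig => fun x : ℤ => ((σ x).1, -(σ x).2)) :=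
    measurable_pi_lambda _ fun x => (measurable_pi_apply x).fst.prodMk (measurable_pi_apply x).snd.neg
  unfold μu
  rw [Measure.map_map hrev measurable_embed]
  have hcomp : (fun σ : ChainConfig => fun x : ℤ => ((σ x).1, -(σ x).2)) ∘ embed = embed ∘ rev1 := by
    funext z; exact reversal_embed z
  rw [hcomp, ← Measure.map_map measurable_embed measurable_rev1, measurePreserving_rev1_ρ.map_eq]

/-- The uniform dynamics preserves the uniform state (Liouville on the shell). [folklore] -/
theorem preservesMeasure_unifDynamics (hω : 0 ≤ ω₂) (hl : 0 ≤ lam) (β γ : ℝ) :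
    (unifDynamics hω hl β γ).PreservesMeasure (μu ω₂ lam) := by
  refine ⟨ae_μu_mem_carrier, fun t => ?_⟩
  have hmeas : Measurable (fun σ : ChainConfig => embed (Φ ω₂ lam t (proj σ))) :=
    measurable_embed.comp ((measurable_Φ t).comp measurable_proj)
  refine ⟨hmeas, ?_⟩
  show ((ρ ω₂ lam).map embed).map (fun σ => embed (Φ ω₂ lam t (proj σ))) = (ρ ω₂ lam).map embed
  rw [Measure.map_map hmeas measurable_embed]
  have hcomp : (fun σ => embed (Φ ω₂ lam t (proj σ))) ∘ embed = embed ∘ Φ ω₂ lam t := by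
    funext z; simp [proj_embed]
  rw [hcomp, ← Measure.map_map measurable_embed (measurable_Φ t), (measurePreserving_Φ_ρ hω hl t).map_eq]

/-- The uniform flow commutes with the shift on the carrier, hence `μu`-a.e. [folklore] -/
theorem shift_comm_unifDynamics (hω : 0 ≤ ω₂) (hl : 0 ≤ lam) (β γ : ℝ) (t : ℝ) :
    ∀ᵐ σ ∂(μu ω₂ lam), (unifDynamics hω hl β γ).flow t (shift σ) = shift ((unifDynamics hω hl β γ).flow t σ) := by
  filter_upwards [ae_μu_mem_carrier] with σ hσ
  simp only [unifDynamics_flow, shift_embed]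
  congr 2
  refine Prod.ext ?_ ?_ <;> funext i <;> simp [proj, shift, hσ.1 1]



end Summit.AtomisticToContinuum.FouriersLaw.Theorems.LocalEnergyHalfHoelder.Negative.UniformOscillationArena

end
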